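import Literature.Barriers.BirchSwinnertonDyer.RankNotSumOfLocalInvariantsF4Twists
import Literature.Barriers.BirchSwinnertonDyer.RankNotSumOfLocalInvariantsF4TwistPoints2993
import HarnessLib

/-!
# `rk E(F₄)` for `E = 480a1`, VI: the eight twists over `ℚ` and the reduction of `rk E(F₄) = 6`
# to six Selmer-sharp `2`-descents

T. Dokchitser–V. Dokchitser, *A note on the Mordell–Weil rank modulo `n`* (J. Number Theory 131
(2011) 1833–1839; arXiv:0910.4588), proof of Thm. 2: for `E = 480a1 : y² = x(x+2)(x-3)` and
`F₄ = ℚ(√-1, √41, √73)`, "2-descent shows that `rk E/ℚ = 1` and `rk E/F₄ = 6` (e.g. using Magma,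
over all minimal non-trivial subfields of `F₄`)". The tree vendors `rk E/F₄ = 6` as the named fact
`DokchitserDokchitser2011_descent_480a1_F4` (`RankNotSumOfLocalInvariantsF4Descent.lean`) and
proves `rk E(F₄) = rk E(K₁) + rk E^{(41)}(K₁) + rk E^{(73)}(K₁) + rk E^{(2993)}(K₁)` over
`K₁ = ℚ(√-1)` (`rank_point_F4_eq`, `RankNotSumOfLocalInvariantsF4Twists.lean`). This file

1. pushes the decomposition down to `ℚ` (Silverman AEC Exercise 10.16 along `K₁/ℚ`, `ℚ(√41)/ℚ`,
   `ℚ(√73)/ℚ`, tree `rank_point_baseChange_quadraticAlgebra`, in the honest form `mordellWeilRank =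
   finrank_ℤ` granted by the Mordell–Weil theorem `module_finite_point_holds`):
   `rk E(F₄) = Σ_{d ∈ {1,-1,41,-41,73,-73,2993,-2993}} rk E^{(d)}(ℚ)` (`mordellWeilRank_F4_eq`,
   `mordellWeilRank_twist_K1`, `mordellWeilRank_K1/K41/K73`), `E^{(d)} = curve480a1.quadraticTwist d`;
2. PROVES the reduction `descent_480a1_F4_of_upper_bounds`: the named fact follows from the six
   upper bounds
   `rk E(ℚ(√41)) ≤ 1`, `rk E(ℚ(√73)) ≤ 1`, `rk E^{(-1)}(ℚ) = 0`, `rk E^{(-41)}(ℚ) ≤ 1`,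
   `rk E^{(-73)}(ℚ) ≤ 1`, `rk E^{(2993)}(ℚ(√-1)) ≤ 3`,
   the matching lower bounds being the theorems of `…F4TwistPoints.lean` / `…F4TwistPoints2993.lean`
   (`rk E(ℚ), rk E^{(-41)}(ℚ), rk E^{(-73)}(ℚ), rk E^{(2993)}(ℚ) ≥ 1`, `rk E^{(-2993)}(ℚ) ≥ 2`):
   `rk E(F₄) = (1 + 0) + (0 + 1) + (0 + 1) + 3 = 6`.

Why these six. They are the complete `2`-descents (Silverman AEC Prop. X.1.4) whose `2`-Selmer
groups are SHARP, i.e. of `𝔽₂`-dimension `rank + 2` (dimensions `3, 3, 2, 3, 3, 5`), as the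
source's "over all minimal non-trivial subfields" indicates: `E` itself is descended over the
minimal subfields `ℚ(√41)`, `ℚ(√73)` (and `E^{(2993)}` over `ℚ(√-1)`). The alternatives are
obstructed by `Ш[2] ≅ (ℤ/2)²`: `dim Sel₂ = 4, 4, 5` for `E^{(41)}, E^{(73)}, E^{(2993)}` over `ℚ`
(ranks `0, 0, 1`) and `dim Sel₂ = 5, 5` for `E^{(41)}, E^{(73)}` over `ℚ(√-1)` (ranks `1, 1`) —
in particular the hypotheses `h₄₁`, `h₇₃` of the tree's `descent_480a1_F4_of_rank_K1` are true but
are not the output of a `2`-descent over `ℚ(√-1)`. (These dimensions are a brute-force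
computation of local images recorded by the author of this file; nothing below depends on them.)
The six descents themselves are not in this file.

Design: ranks are `WeierstrassCurve.mordellWeilRank` throughout (natural numbers; the point
groups over `ℚ` thereby carry the classical `DecidableEq` instance of the tree's general-field
theorems, cf. `QuadraticTwistRank.lean`), and the two `Algebra ℚ K` instances on a quadratic
algebra (`DivisionRing.toRatAlgebra`, `QuadraticAlgebra.instAlgebra`; definitionally equal) are
bridged by `exact`, as in `RankNotSumOfLocalInvariantsF4Field.lean`.

## References

* T. Dokchitser, V. Dokchitser, *A note on the Mordell–Weil rank modulo `n`*, J. Number Theory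
  131 (2011) 1833–1839, arXiv:0910.4588, proof of Thm. 2. [DokchitserDokchitser2011RankModN]
* J. H. Silverman, *The Arithmetic of Elliptic Curves*, 2nd ed., GTM 106 (2009), Exercise 10.16,
  Prop. X.1.4, Thm. VIII.6.7. [SilvermanAEC2009]
-/

noncomputable section

attribute [-instance] instDecidableEqQuadraticAlgebra

open scoped Classical

open QuadraticAlgebra WeierstrassCurve

namespace Literature.Barriers.BirchSwinnertonDyer

namespace DokchitserDokchitser2011

/-! ### The fields `ℚ(√-1)`, `ℚ(√41)`, `ℚ(√73)` as number fields -/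

/-- `K1 = ℚ(√-1)` is a number field. [folklore] -/
instance K1.instNumberField : NumberField K1 := NumberField.mk

/-- The real quadratic field `ℚ(√41)`, as the quadratic algebra `ℚ[ω]/(ω² - 41)`. [folklore] -/
abbrev K41 : Type := QuadraticAlgebra ℚ 41 0

/-- `41` is not a square in `ℚ`, so `K41 = ℚ(√41)` is a field. [folklore] -/
instance K41.instFact : Fact (∀ r : ℚ, r ^ 2 ≠ (41 : ℚ) + 0 * r) :=
  ⟨fun r h => by
    rw [zero_mul, add_zero, sq] at h
    exact rat_mul_self_ne (by norm_num) r h⟩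

/-- `K41 = ℚ(√41)` is a number field. [folklore] -/
instance K41.instNumberField : NumberField K41 := NumberField.mk

/-- The real quadratic field `ℚ(√73)`, as the quadratic algebra `ℚ[ω]/(ω² - 73)`. [folklore] -/
abbrev K73 : Type := QuadraticAlgebra ℚ 73 0

/-- `73` is not a square in `ℚ`, so `K73 = ℚ(√73)` is a field. [folklore] -/
instance K73.instFact : Fact (∀ r : ℚ, r ^ 2 ≠ (73 : ℚ) + 0 * r) :=
  ⟨fun r h => by
    rw [zero_mul, add_zero, sq] at h
    exact rat_mul_self_ne (by norm_num) r h⟩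

/-- `K73 = ℚ(√73)` is a number field. [folklore] -/
instance K73.instNumberField : NumberField K73 := NumberField.mk

/-- `E^{(41)}` is an elliptic curve. [folklore] -/
instance isElliptic_twist_41 : (curve480a1.quadraticTwist 41).IsElliptic :=
  isElliptic_twist (by norm_num)

/-- `E^{(73)}` is an elliptic curve. [folklore] -/
instance isElliptic_twist_73 : (curve480a1.quadraticTwist 73).IsElliptic :=
  isElliptic_twist (by norm_num)

/-- `E^{(-1)}` is an elliptic curve. [folklore] -/
instance isElliptic_twist_neg1 : (curve480a1.quadraticTwist (-1)).IsElliptic :=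
  isElliptic_twist (by norm_num)

/-! ### From cardinal rank identities to `mordellWeilRank` identities -/

/-- If `rank_ℤ M = rank_ℤ N + rank_ℤ P` with `rank_ℤ M` finite then the same holds for `finrank_ℤ`.
[folklore] -/
theorem finrank_eq_add_of_rank_eq {M N P : Type} [AddCommGroup M] [AddCommGroup N]
    [AddCommGroup P] (hM : Module.rank ℤ M < Cardinal.aleph0)
    (h : Module.rank ℤ M = Module.rank ℤ N + Module.rank ℤ P) :
    Module.finrank ℤ M = Module.finrank ℤ N + Module.finrank ℤ P := by
  rw [h, Cardinal.add_lt_aleph0_iff] at hM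
  unfold Module.finrank
  rw [h, Cardinal.toNat_add hM.1 hM.2]

/-- **`rk E^{(d)}(ℚ(√-1)) = rk E^{(d)}(ℚ) + rk E^{(-d)}(ℚ)`** for the twists of `E = 480a1`, `d ≠ 0`
(Silverman AEC Exercise 10.16 along `K1 = ℚ(√-1)`, tree `rank_point_baseChange_quadraticAlgebra`,
`(E^{(d)})^{(-1)} = E^{(-d)}`, and Mordell–Weil over `K1`). [cite: SilvermanAEC2009, Exercise 10.16] -/
theorem mordellWeilRank_twist_K1 (d : ℚ) [(curve480a1.quadraticTwist d).IsElliptic] :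
    ((curve480a1.quadraticTwist d).baseChange K1).mordellWeilRank =
      (curve480a1.quadraticTwist d).mordellWeilRank +
        (curve480a1.quadraticTwist (-d)).mordellWeilRank := by
  haveI : ((curve480a1.quadraticTwist d).baseChange K1).IsElliptic :=
    inferInstanceAs ((curve480a1.quadraticTwist d).map (algebraMap ℚ K1)).IsElliptic
  have hfin : Module.rank ℤ ((curve480a1.quadraticTwist d).baseChange K1).toAffine.Point <
      Cardinal.aleph0 := by
    haveI := ((curve480a1.quadraticTwist d).baseChange K1).module_finite_point_holds
    exact Module.rank_lt_aleph0 ℤ _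
  letI : DecidableEq ℚ := fun a b => Classical.propDecidable (a = b)
  -- the tree theorem is stated with `QuadraticAlgebra.instAlgebra`, our curves with
  -- `DivisionRing.toRatAlgebra` (definitionally equal `Algebra ℚ K1` instances): realign by `exact`
  have h : Module.rank ℤ ((curve480a1.quadraticTwist d).baseChange K1).toAffine.Point =
      Module.rank ℤ (curve480a1.quadraticTwist d).toAffine.Point +
        Module.rank ℤ (curve480a1.quadraticTwist (-d)).toAffine.Point := by
    have h0 := rank_point_baseChange_quadraticAlgebra (-1 : ℚ) (curve480a1.quadraticTwist d)
    rw [quadraticTwist_quadraticTwist, mul_neg_one] at h0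
    exact h0
  unfold WeierstrassCurve.mordellWeilRank
  exact finrank_eq_add_of_rank_eq hfin h

/-- `rk E(ℚ(√-1)) = rk E(ℚ) + rk E^{(-1)}(ℚ)` for `E = 480a1`. [cite: SilvermanAEC2009, Exercise 10.16] -/
theorem mordellWeilRank_K1 :
    (curve480a1.baseChange K1).mordellWeilRank =
      curve480a1.mordellWeilRank + (curve480a1.quadraticTwist (-1)).mordellWeilRank := by
  haveI : (curve480a1.baseChange K1).IsElliptic :=
    inferInstanceAs (curve480a1.map (algebraMap ℚ K1)).IsElliptic
  have hfin : Module.rank ℤ (curve480a1.baseChange K1).toAffine.Point < Cardinal.aleph0 := by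
    haveI := (curve480a1.baseChange K1).module_finite_point_holds
    exact Module.rank_lt_aleph0 ℤ _
  letI : DecidableEq ℚ := fun a b => Classical.propDecidable (a = b)
  have h : Module.rank ℤ (curve480a1.baseChange K1).toAffine.Point =
      Module.rank ℤ curve480a1.toAffine.Point +
        Module.rank ℤ (curve480a1.quadraticTwist (-1)).toAffine.Point :=
    rank_point_baseChange_quadraticAlgebra (-1 : ℚ) curve480a1
  unfold WeierstrassCurve.mordellWeilRank
  exact finrank_eq_add_of_rank_eq hfin h

/-- `rk E(ℚ(√41)) = rk E(ℚ) + rk E^{(41)}(ℚ)` for `E = 480a1`. [cite: SilvermanAEC2009, Exercise 10.16] -/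
theorem mordellWeilRank_K41 :
    (curve480a1.baseChange K41).mordellWeilRank =
      curve480a1.mordellWeilRank + (curve480a1.quadraticTwist 41).mordellWeilRank := by
  haveI : (curve480a1.baseChange K41).IsElliptic :=
    inferInstanceAs (curve480a1.map (algebraMap ℚ K41)).IsElliptic
  have hfin : Module.rank ℤ (curve480a1.baseChange K41).toAffine.Point < Cardinal.aleph0 := by
    haveI := (curve480a1.baseChange K41).module_finite_point_holds
    exact Module.rank_lt_aleph0 ℤ _
  letI : DecidableEq ℚ := fun a b => Classical.propDecidable (a = b)
  have h : Module.rank ℤ (curve480a1.baseChange K41).toAffine.Point =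
      Module.rank ℤ curve480a1.toAffine.Point +
        Module.rank ℤ (curve480a1.quadraticTwist 41).toAffine.Point :=
    rank_point_baseChange_quadraticAlgebra (41 : ℚ) curve480a1
  unfold WeierstrassCurve.mordellWeilRank
  exact finrank_eq_add_of_rank_eq hfin h

/-- `rk E(ℚ(√73)) = rk E(ℚ) + rk E^{(73)}(ℚ)` for `E = 480a1`. [cite: SilvermanAEC2009, Exercise 10.16] -/
theorem mordellWeilRank_K73 :
    (curve480a1.baseChange K73).mordellWeilRank =
      curve480a1.mordellWeilRank + (curve480a1.quadraticTwist 73).mordellWeilRank := by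
  haveI : (curve480a1.baseChange K73).IsElliptic :=
    inferInstanceAs (curve480a1.map (algebraMap ℚ K73)).IsElliptic
  have hfin : Module.rank ℤ (curve480a1.baseChange K73).toAffine.Point < Cardinal.aleph0 := by
    haveI := (curve480a1.baseChange K73).module_finite_point_holds
    exact Module.rank_lt_aleph0 ℤ _
  letI : DecidableEq ℚ := fun a b => Classical.propDecidable (a = b)
  have h : Module.rank ℤ (curve480a1.baseChange K73).toAffine.Point =
      Module.rank ℤ curve480a1.toAffine.Point +
        Module.rank ℤ (curve480a1.quadraticTwist 73).toAffine.Point :=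
    rank_point_baseChange_quadraticAlgebra (73 : ℚ) curve480a1
  unfold WeierstrassCurve.mordellWeilRank
  exact finrank_eq_add_of_rank_eq hfin h

/-- The tree's `rank_point_F4_eq` in terms of `mordellWeilRank`:
`rk E(F₄) = rk E(K₁) + rk E^{(41)}(K₁) + rk E^{(73)}(K₁) + rk E^{(2993)}(K₁)` (honest by
Mordell–Weil over `F₄`). [cite: DokchitserDokchitser2011RankModN, proof of Thm. 2] -/
theorem mordellWeilRank_F4_eq :
    (curve480a1.baseChange F4).mordellWeilRank =
      (curve480a1.baseChange K1).mordellWeilRank +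
        ((curve480a1.quadraticTwist 41).baseChange K1).mordellWeilRank +
        ((curve480a1.quadraticTwist 73).baseChange K1).mordellWeilRank +
        ((curve480a1.quadraticTwist 2993).baseChange K1).mordellWeilRank := by
  haveI : (curve480a1.baseChange F4).IsElliptic :=
    inferInstanceAs (curve480a1.map (algebraMap ℚ F4)).IsElliptic
  have hfin : Module.rank ℤ (curve480a1.baseChange F4).toAffine.Point < Cardinal.aleph0 := by
    haveI := (curve480a1.baseChange F4).module_finite_point_holds
    exact Module.rank_lt_aleph0 ℤ _
  have h := rank_point_F4_eq
  rw [h] at hfin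
  obtain ⟨habc, hd⟩ := Cardinal.add_lt_aleph0_iff.1 hfin
  obtain ⟨hab, hc⟩ := Cardinal.add_lt_aleph0_iff.1 habc
  obtain ⟨ha, hb⟩ := Cardinal.add_lt_aleph0_iff.1 hab
  unfold WeierstrassCurve.mordellWeilRank Module.finrank
  rw [h, Cardinal.toNat_add habc hd, Cardinal.toNat_add hab hc, Cardinal.toNat_add ha hb]

/-- **`rk E(F₄)` is the sum of the ranks of the eight quadratic twists over `ℚ`**: for `E = 480a1`,
`rk E(F₄) = Σ_{d ∈ {1,-1,41,-41,73,-73,2993,-2993}} rk E^{(d)}(ℚ)`.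
[cite: DokchitserDokchitser2011RankModN, proof of Thm. 2] -/
theorem mordellWeilRank_F4_eq_sum_twists :
    (curve480a1.baseChange F4).mordellWeilRank =
      curve480a1.mordellWeilRank + (curve480a1.quadraticTwist (-1)).mordellWeilRank +
      ((curve480a1.quadraticTwist 41).mordellWeilRank +
        (curve480a1.quadraticTwist (-41)).mordellWeilRank) +
      ((curve480a1.quadraticTwist 73).mordellWeilRank +
        (curve480a1.quadraticTwist (-73)).mordellWeilRank) +
      ((curve480a1.quadraticTwist 2993).mordellWeilRank +
        (curve480a1.quadraticTwist (-2993)).mordellWeilRank) := by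
  rw [mordellWeilRank_F4_eq, mordellWeilRank_K1, mordellWeilRank_twist_K1, mordellWeilRank_twist_K1,
    mordellWeilRank_twist_K1]

/-- **Reduction of the descent leaf `rk E(F₄) = 6` to six Selmer-sharp `2`-descents.** For
`E = 480a1`, the named fact `DokchitserDokchitser2011_descent_480a1_F4`
(`(curve480a1.baseChange F4).mordellWeilRank = 6`) follows from the upper bounds
`rk E(ℚ(√41)) ≤ 1`, `rk E(ℚ(√73)) ≤ 1` (descents of `E` over the minimal subfields `ℚ(√41)`,
`ℚ(√73)` of `F₄`), `rk E^{(-1)}(ℚ) = 0`, `rk E^{(-41)}(ℚ) ≤ 1`, `rk E^{(-73)}(ℚ) ≤ 1` (descents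
over `ℚ`) and `rk E^{(2993)}(ℚ(√-1)) ≤ 3` (descent of `E^{(2993)}` over the minimal subfield
`ℚ(√-1)`), by `mordellWeilRank_F4_eq_sum_twists` and the proved lower bounds
`one_le_mordellWeilRank_480a1/neg41/neg73/2993`, `two_le_mordellWeilRank_neg2993`:
`rk E(F₄) = (1 + 0) + (0 + 1) + (0 + 1) + 3 = 6`.
[cite: DokchitserDokchitser2011RankModN, proof of Thm. 2] -/
theorem descent_480a1_F4_of_upper_bounds
    (hU41 : (curve480a1.baseChange K41).mordellWeilRank ≤ 1)
    (hU73 : (curve480a1.baseChange K73).mordellWeilRank ≤ 1)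
    (hUm1 : (curve480a1.quadraticTwist (-1)).mordellWeilRank = 0)
    (hUm41 : (curve480a1.quadraticTwist (-41)).mordellWeilRank ≤ 1)
    (hUm73 : (curve480a1.quadraticTwist (-73)).mordellWeilRank ≤ 1)
    (hU2993 : ((curve480a1.quadraticTwist 2993).baseChange K1).mordellWeilRank ≤ 3) :
    DokchitserDokchitser2011_descent_480a1_F4 := by
  have e41 := mordellWeilRank_K41
  have e73 := mordellWeilRank_K73
  have t2993 := mordellWeilRank_twist_K1 2993
  have f4 := mordellWeilRank_F4_eq_sum_twists
  have l1 := one_le_mordellWeilRank_480a1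
  have l41 := one_le_mordellWeilRank_neg41
  have l73 := one_le_mordellWeilRank_neg73
  have l2993 := one_le_mordellWeilRank_2993
  have l2 := two_le_mordellWeilRank_neg2993
  show (curve480a1.baseChange F4).mordellWeilRank = 6
  omega

/-- The same reduction for the vendored field-theoretic statement
`DokchitserDokchitser2011_rank_480a1_F4` (tree `…_rank_480a1_F4_of_descent`).
[cite: DokchitserDokchitser2011RankModN, proof of Thm. 2] -/
theorem rank_480a1_F4_of_upper_bounds
    (hU41 : (curve480a1.baseChange K41).mordellWeilRank ≤ 1)
    (hU73 : (curve480a1.baseChange K73).mordellWeilRank ≤ 1)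
    (hUm1 : (curve480a1.quadraticTwist (-1)).mordellWeilRank = 0)
    (hUm41 : (curve480a1.quadraticTwist (-41)).mordellWeilRank ≤ 1)
    (hUm73 : (curve480a1.quadraticTwist (-73)).mordellWeilRank ≤ 1)
    (hU2993 : ((curve480a1.quadraticTwist 2993).baseChange K1).mordellWeilRank ≤ 3) :
    DokchitserDokchitser2011_rank_480a1_F4 :=
  DokchitserDokchitser2011_rank_480a1_F4_of_descent
    (descent_480a1_F4_of_upper_bounds hU41 hU73 hUm1 hUm41 hUm73 hU2993)

end DokchitserDokchitser2011

end Literature.Barriers.BirchSwinnertonDyer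

end
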